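import Summits.SmoothPoincare4.SmoothPoincare4.Theorems.SullivanDualWitnessChargeHelperMemberGraphMain
import Summits.SmoothPoincare4.SmoothPoincare4.Theorems.SullivanDualWitnessChargeHelperEndHolomorphic
import Summits.SmoothPoincare4.SmoothPoincare4.Theorems.SullivanDualWitnessChargeHelperSigmaOmitted
import Mathlib.Analysis.Complex.Basic

/-!
# Helper `helper_memberNearBound_of` of line `Sketch` for crux `WitnessCharge`
(item stmt-SmoothPoincare4-7824, route `SullivanDual`, crux
`Summit.SmoothPoincare4.SmoothPoincare4.Theses.SullivanDual.WitnessCharge`; registered stub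
`helper_memberNearBound_of` of the lead's cycle-2 helper skeleton, (N)-branch uniform control)

UNIFORM NEAR BOUND for pencil members. Let `J` be standard on the punctured `ε'`-chart-ball `B_{ε'}`
at `p` (closed ball inside the chart target), `u` a pencil member of intercept `b`
(`IsPencilMember J u b`), `φ ξ = z(u ξ) = (Ycoord p (u ξ)).1` its first flat coordinate, and
`R > ε'⁻¹`. ASSUMING the far-covering property (the registered neighbour `helper_memberFarCovers`,
taken here as the hypothesis `hcov`): every `ξ` with `2R < ‖ξ‖` lies in
`G_R = {ξ | u ξ ∈ B_{ε'}, R < ‖φ ξ‖}`, we prove the bound, uniform in the member,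
`‖φ ξ‖ ≤ 2r` whenever `r ≥ 2R`, `‖ξ‖ ≤ r` and `u ξ ∈ B_{ε'}`.

Proof. If `‖φ ξ‖ ≤ R` we are done (`R ≤ 2R ≤ r ≤ 2r`). Otherwise `ξ ∈ G_R`. The exterior
`V = {r < ‖ξ'‖}` is contained in `G_R` by `hcov`; `φ` is holomorphic on `u⁻¹(B_{ε'}) ⊇ G_R`
(`helper_endHolomorphic`), injective on `G_R` (`helper_memberGraph`), and `φ ξ' - ξ' → 0` at infinity
(member axiom). The value `c = φ ξ` is omitted by `φ` on `V`: a preimage `ξ' ∈ V ⊆ G_R` would equal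
`ξ ∈ G_R` by injectivity, contradicting `‖ξ‖ ≤ r < ‖ξ'‖`. The omitted-value bound for the class
`Σ` rescaled to radius `r` (`helper_sigmaOmitted`: Pommerenke, *Univalent Functions* (1975),
Thm. 1.5) gives `‖φ ξ‖ ≤ 2r`.

Everything here is proved; no facts and no `Prop`-valued definitions are introduced.
-/

noncomputable section

-- the prescribed namespace `Summit.<P>.<Sub>.…` duplicates `SmoothPoincare4` (P = Sub)
set_option linter.dupNamespace false

open scoped Manifold ContDiff Topology
open Set Filter Literature.Geometry.Kaehler Literature.Geometry.Symplectic
  Literature.Topology.FourManifolds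

namespace Summit.SmoothPoincare4.SmoothPoincare4.Theorems.WitnessCharge.PencilIncompleteness

/-- **Complex-analytic core of the near bound.** If `φ` is holomorphic and injective on a set
`G ⊇ {2R < ‖ξ‖}` (`R > 0`) with `φ z - z → 0` at infinity, then for `r ≥ 2R` every point `ξ ∈ G`
with `‖ξ‖ ≤ r` satisfies `‖φ ξ‖ ≤ 2r`: the value `φ ξ` is omitted by `φ` on `{r < ‖z‖} ⊆ G`
(injectivity), and the omitted-value bound `helper_sigmaOmitted` at radius `r` applies. -/
theorem helper_memberNearBound_core {φ : ℂ → ℂ} {G : Set ℂ} {R r : ℝ} (hR : 0 < R)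
    (hr : 2 * R ≤ r) (hcov : ∀ ξ : ℂ, 2 * R < ‖ξ‖ → ξ ∈ G)
    (hd : DifferentiableOn ℂ φ G) (hinj : InjOn φ G)
    (hlim : Tendsto (fun z : ℂ => φ z - z) (cocompact ℂ) (𝓝 0))
    {ξ : ℂ} (hξ : ‖ξ‖ ≤ r) (hξG : ξ ∈ G) : ‖φ ξ‖ ≤ 2 * r := by
  have hr0 : 0 < r := by linarith
  have hVG : {z : ℂ | r < ‖z‖} ⊆ G := fun z hz => hcov z (by
    have hz' : r < ‖z‖ := hz
    linarith)
  refine helper_sigmaOmitted r hr0 φ (hd.mono hVG) (hinj.mono hVG) hlim (φ ξ) ?_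
  rintro ⟨ξ', hξ', hEq⟩
  have hξ'r : r < ‖ξ'‖ := hξ'
  have h : ξ' = ξ := hinj (hVG hξ') hξG hEq
  rw [h] at hξ'r
  exact absurd hξ (not_le.2 hξ'r)

/-- **Helper `helper_memberNearBound_of` ((N)-branch uniform control, near part).** For `J`
standard on the punctured `ε'`-chart-ball at `p` (closed ball inside the chart target) and a pencil
member `u` of intercept `b`, GIVEN the far-covering property of members (first hypothesis: for
`R > ε'⁻¹`, every `ξ` with `2R < ‖ξ‖` has `u ξ ∈ B_{ε'}` and `R < ‖z(u ξ)‖`), the first flat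
coordinate obeys the bound `‖z(u ξ)‖ ≤ 2r`, UNIFORM IN THE MEMBER, for all `R > ε'⁻¹`, `r ≥ 2R`,
`‖ξ‖ ≤ r` with `u ξ ∈ B_{ε'}` (holomorphy in the end, the graph property over `{R < |z|}`, and
the omitted-value bound for the class `Σ`). -/
theorem helper_memberNearBound_of :
    (∀ (S : HomotopySphere 4) (p : S.carrier)
      (J : ∀ x : punctured p, TangentSpace (𝓡 4) x →L[ℝ] TangentSpace (𝓡 4) x) (ε' : ℝ)
      (u : ℂ → punctured p) (b : ℂ),
      0 < ε' →
      Metric.closedBall (extChartAt (𝓡 4) p p) ε' ⊆ (extChartAt (𝓡 4) p).target →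
      (∀ x : punctured p, InPuncturedChartBall p ε' x →
        ∀ (v : TangentSpace (𝓡 4) x) (b : EuclideanSpace ℝ (Fin 4)),
          inner ℝ (fderiv ℝ inversion (extChartAt (𝓡 4) p x.1 - extChartAt (𝓡 4) p p)
            (mfderiv (𝓡 4) 𝓘(ℝ, EuclideanSpace ℝ (Fin 4))
              (fun z : punctured p => extChartAt (𝓡 4) p z.1) x (J x v))) b
          = stdSymplecticForm (fderiv ℝ inversion (extChartAt (𝓡 4) p x.1 - extChartAt (𝓡 4) p p)
            (mfderiv (𝓡 4) 𝓘(ℝ, EuclideanSpace ℝ (Fin 4))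
              (fun z : punctured p => extChartAt (𝓡 4) p z.1) x v)) b) →
      IsPencilMember J u b →
      ∀ R : ℝ, ε'⁻¹ < R → ∀ ξ : ℂ, 2 * R < ‖ξ‖ →
        InPuncturedChartBall p ε' (u ξ) ∧ R < ‖(Ycoord p (u ξ)).1‖) →
    ∀ (S : HomotopySphere 4) (p : S.carrier)
      (J : ∀ x : punctured p, TangentSpace (𝓡 4) x →L[ℝ] TangentSpace (𝓡 4) x) (ε' : ℝ)
      (u : ℂ → punctured p) (b : ℂ),
      0 < ε' →
      Metric.closedBall (extChartAt (𝓡 4) p p) ε' ⊆ (extChartAt (𝓡 4) p).target →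
      (∀ x : punctured p, InPuncturedChartBall p ε' x →
        ∀ (v : TangentSpace (𝓡 4) x) (b : EuclideanSpace ℝ (Fin 4)),
          inner ℝ (fderiv ℝ inversion (extChartAt (𝓡 4) p x.1 - extChartAt (𝓡 4) p p)
            (mfderiv (𝓡 4) 𝓘(ℝ, EuclideanSpace ℝ (Fin 4))
              (fun z : punctured p => extChartAt (𝓡 4) p z.1) x (J x v))) b
          = stdSymplecticForm (fderiv ℝ inversion (extChartAt (𝓡 4) p x.1 - extChartAt (𝓡 4) p p)
            (mfderiv (𝓡 4) 𝓘(ℝ, EuclideanSpace ℝ (Fin 4))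
              (fun z : punctured p => extChartAt (𝓡 4) p z.1) x v)) b) →
      IsPencilMember J u b →
      ∀ R : ℝ, ε'⁻¹ < R → ∀ r : ℝ, 2 * R ≤ r → ∀ ξ : ℂ, ‖ξ‖ ≤ r →
        InPuncturedChartBall p ε' (u ξ) → ‖(Ycoord p (u ξ)).1‖ ≤ 2 * r := by
  intro hcov S p J ε' u b hε' hball hJstd hmem R hR r hr ξ hξ hball'
  have hR0 : 0 < R := (inv_pos.2 hε').trans hR
  rcases le_or_gt ‖(Ycoord p (u ξ)).1‖ R with hle | hlt
  · -- near values: `‖φ ξ‖ ≤ R ≤ 2R ≤ r ≤ 2r`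
    linarith
  · -- `ξ ∈ G_R`; holomorphy in the end, the graph property and the omitted-value bound
    obtain ⟨hu, -, hhol⟩ := hmem.1
    have hE := helper_endHolomorphic S p J ε' hε' hball hJstd u hu hhol
    have hG := (helper_memberGraph S p J ε' u b hε' hball hJstd hmem R hR).1
    have hd : DifferentiableOn ℂ (fun ξ : ℂ => (Ycoord p (u ξ)).1)
        {ξ : ℂ | InPuncturedChartBall p ε' (u ξ) ∧ R < ‖(Ycoord p (u ξ)).1‖} :=
      (hE.2.1.mono fun ξ' hξ' => hξ'.1).fst
    exact helper_memberNearBound_core hR0 hr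
      (fun ξ' hξ' => hcov S p J ε' u b hε' hball hJstd hmem R hR ξ' hξ') hd hG.injOn
      hmem.2.2.2.2.1 hξ ⟨hball', hlt⟩

end Summit.SmoothPoincare4.SmoothPoincare4.Theorems.WitnessCharge.PencilIncompleteness
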